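import Mathlib

/-!
# T5CircleCharacters — the continuous characters of the circle group are `z ↦ z ^ n`

Support (seat p1, blind lane) for route/T5-N4-p5.md v10 (N4.3 = (R3), rows P2′ «the SO(2)-weights are
exactly {3, 5, 7, …}») and for the last-column item of route/T5-SUPPORT-p1.md §S4.11 / §S4.12
«the classification of the continuous characters of SO(2) as e^{inθ}, n ∈ ℤ (not in Mathlib)».
Mathlib only; nothing here is about (N), U(1,1) or π₃⁺.

Main statements (all kernel-checked, standard axioms):
* `exists_lift` — a continuous `f : ℝ → Circle` with `f 0 = 1` lifts through the covering map
  `Circle.exp` to a continuous `F : ℝ → ℝ` with `F 0 = 0` (Mathlib's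
  `IsCoveringMap.existsUnique_continuousMap_lifts`; `ℝ` is contractible and locally path-connected);
* `lift_unique` — two continuous lifts agreeing at one point agree everywhere;
* `lift_add` — the lift of a continuous HOMOMORPHISM `f` (`f (s + t) = f s * f t`) is additive
  (uniqueness of lifts applied to `t ↦ F (s + t) - F s`);
* `exists_real_of_continuous_hom` — every continuous homomorphism `f : ℝ → Circle` is
  `t ↦ Circle.exp (c * t)` for some `c : ℝ` (the additive continuous lift is `ℝ`-linear:
  `map_real_smul`); `real_unique` — `c` is unique;
* `exists_int_of_continuous_hom_periodic` — if moreover `f (2π) = 1` then `c = n ∈ ℤ`;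
* `exists_zpow_eq` — every continuous monoid homomorphism `φ : Circle →* Circle` is `z ↦ z ^ n`;
  `zpow_injective` — `n` is unique;
* `exists_zpow_eq_of_norm_eq_one` — every continuous unimodular character `χ : Circle →* ℂˣ` is
  `z ↦ z ^ n` (the shape of the weights `lineWeight` of T5WeightDecomposition for `K = Circle`);
* `exists_int_of_continuous_unimodular_periodic` — the `SO(2) = ℝ/2πℤ` form: a continuous
  multiplicative unimodular `χ : ℝ → ℂ` with `χ (2π) = 1` is `θ ↦ exp (i n θ)`.
-/

namespace Summit.Ventures.HodgeRepro2.T5CircleCharacters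

open Real Complex

/-- A continuous map `f : ℝ → Circle` with `f 0 = 1` lifts through `Circle.exp` to a continuous
`F : ℝ → ℝ` with `F 0 = 0`. -/
theorem exists_lift (f : ℝ → Circle) (hf : Continuous f) (h0 : f 0 = 1) :
    ∃ F : ℝ → ℝ, Continuous F ∧ F 0 = 0 ∧ ∀ t, Circle.exp (F t) = f t := by
  obtain ⟨F, ⟨hF0, hFf⟩, -⟩ :=
    Circle.isCoveringMap_exp.existsUnique_continuousMap_lifts ⟨f, hf⟩ 0 0 (by simp [h0])
  exact ⟨F, F.continuous, hF0, fun t => congrFun hFf t⟩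

/-- Uniqueness of lifts through `Circle.exp`: two continuous lifts of the same map `f` which agree
at `0` agree everywhere. -/
theorem lift_unique {f : ℝ → Circle} {F G : ℝ → ℝ} (hF : Continuous F) (hG : Continuous G)
    (hF0 : F 0 = G 0) (hFf : ∀ t, Circle.exp (F t) = f t) (hGf : ∀ t, Circle.exp (G t) = f t) :
    F = G := by
  have hf : Continuous f := by
    have : f = Circle.exp ∘ F := funext fun t => (hFf t).symm
    rw [this]
    exact Circle.exp.continuous.comp hF
  obtain ⟨H, -, huniq⟩ :=
    Circle.isCoveringMap_exp.existsUnique_continuousMap_lifts ⟨f, hf⟩ 0 (F 0) (hFf 0)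
  have h1 : (⟨F, hF⟩ : C(ℝ, ℝ)) = H := huniq ⟨F, hF⟩ ⟨rfl, funext hFf⟩
  have h2 : (⟨G, hG⟩ : C(ℝ, ℝ)) = H := huniq ⟨G, hG⟩ ⟨hF0.symm, funext hGf⟩
  have h3 : (⟨F, hF⟩ : C(ℝ, ℝ)) = ⟨G, hG⟩ := h1.trans h2.symm
  exact congrArg (fun H : C(ℝ, ℝ) => (H : ℝ → ℝ)) h3

/-- The lift of a continuous homomorphism `ℝ → Circle` is additive. -/
theorem lift_add {f : ℝ → Circle} (hmul : ∀ s t, f (s + t) = f s * f t) {F : ℝ → ℝ}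
    (hF : Continuous F) (hF0 : F 0 = 0) (hFf : ∀ t, Circle.exp (F t) = f t) (s t : ℝ) :
    F (s + t) = F s + F t := by
  have key : (fun t => F (s + t) - F s) = F := by
    refine lift_unique (f := f) (by fun_prop) hF (by simp [hF0]) (fun t => ?_) hFf
    rw [Circle.exp_sub, hFf, hFf, hmul, mul_div_cancel_left]
  have h : F (s + t) - F s = F t := congrFun key t
  linarith

/-- A continuous homomorphism `f : ℝ → Circle` has `f 0 = 1`. -/
theorem map_zero_of_hom {f : ℝ → Circle} (hmul : ∀ s t, f (s + t) = f s * f t) : f 0 = 1 := by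
  have := hmul 0 0
  rw [add_zero] at this
  exact left_eq_mul.1 this

/-- Every continuous homomorphism `f : ℝ → Circle` is `t ↦ Circle.exp (c * t)` for some `c : ℝ`. -/
theorem exists_real_of_continuous_hom (f : ℝ → Circle) (hf : Continuous f)
    (hmul : ∀ s t, f (s + t) = f s * f t) :
    ∃ c : ℝ, ∀ t, f t = Circle.exp (c * t) := by
  obtain ⟨F, hF, hF0, hFf⟩ := exists_lift f hf (map_zero_of_hom hmul)
  have hadd : ∀ s t, F (s + t) = F s + F t := lift_add hmul hF hF0 hFf
  let Fh : ℝ →+ ℝ := { toFun := F, map_zero' := hF0, map_add' := hadd }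
  refine ⟨F 1, fun t => ?_⟩
  have hlin : Fh (t • (1 : ℝ)) = t • Fh 1 := map_real_smul Fh hF t 1
  simp only [smul_eq_mul, mul_one] at hlin
  rw [← hFf t]
  congr 1
  rw [mul_comm]
  exact hlin

/-- The parameter `c` of `exists_real_of_continuous_hom` is unique. -/
theorem real_unique {c c' : ℝ} (h : ∀ t, Circle.exp (c * t) = Circle.exp (c' * t)) : c = c' := by
  by_contra hne
  have hd : c - c' ≠ 0 := sub_ne_zero.2 hne
  have h1 := h (π / (c - c'))
  rw [Circle.exp_eq_exp] at h1
  obtain ⟨m, hm⟩ := h1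
  have h2 : (c - c') * (π / (c - c')) = m * (2 * π) := by linarith
  rw [mul_div_cancel₀ _ hd] at h2
  have h3 : (1 : ℝ) = m * 2 := by
    have hpi : (π : ℝ) ≠ 0 := Real.pi_ne_zero
    field_simp at h2
    nlinarith [h2, Real.pi_pos]
  have h4 : (1 : ℤ) = m * 2 := by exact_mod_cast h3
  omega

/-- A continuous homomorphism `f : ℝ → Circle` with `f (2π) = 1` is `t ↦ Circle.exp (n * t)` for an
integer `n`: the continuous characters of `ℝ / 2πℤ` are the `e^{inθ}`. -/
theorem exists_int_of_continuous_hom_periodic (f : ℝ → Circle) (hf : Continuous f)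
    (hmul : ∀ s t, f (s + t) = f s * f t) (hper : f (2 * π) = 1) :
    ∃ n : ℤ, ∀ t, f t = Circle.exp (n * t) := by
  obtain ⟨c, hc⟩ := exists_real_of_continuous_hom f hf hmul
  have h1 : Circle.exp (c * (2 * π)) = 1 := by rw [← hc, hper]
  obtain ⟨n, hn⟩ := Circle.exp_eq_one.1 h1
  have hpi : (2 * π : ℝ) ≠ 0 := by positivity
  have hcn : c = n := mul_right_cancel₀ hpi hn
  exact ⟨n, fun t => by rw [hc, hcn]⟩

/-- Every continuous monoid homomorphism `φ : Circle →* Circle` is `z ↦ z ^ n` for some `n : ℤ`. -/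
theorem exists_zpow_eq (φ : Circle →* Circle) (hφ : Continuous φ) :
    ∃ n : ℤ, ∀ z, φ z = z ^ n := by
  obtain ⟨n, hn⟩ := exists_int_of_continuous_hom_periodic (fun t => φ (Circle.exp t))
    (hφ.comp Circle.exp.continuous) (fun s t => by simp [Circle.exp_add, map_mul]) (by simp)
  refine ⟨n, fun z => ?_⟩
  obtain ⟨t, rfl⟩ := Circle.exp_surjective z
  rw [hn t, Circle.exp_intCast_mul]

/-- The exponent `n` is determined by the character `z ↦ z ^ n`. -/
theorem zpow_injective {n m : ℤ} (h : ∀ z : Circle, z ^ n = z ^ m) : n = m := by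
  by_contra hne
  have hd : (n - m : ℤ) ≠ 0 := sub_ne_zero.2 hne
  have hd' : ((n : ℝ) - m) ≠ 0 := by exact_mod_cast hd
  have h1 : (Circle.exp (π / ((n : ℝ) - m))) ^ (n - m) = 1 := by
    rw [zpow_sub, h]
    exact mul_inv_cancel _
  rw [← Circle.exp_intCast_mul, Circle.exp_eq_one] at h1
  obtain ⟨k, hk⟩ := h1
  push_cast at hk
  rw [mul_div_cancel₀ _ hd'] at hk
  have h3 : (1 : ℝ) = k * 2 := by
    have hpi : (π : ℝ) ≠ 0 := Real.pi_ne_zero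
    nlinarith [hk, Real.pi_pos]
  have h4 : (1 : ℤ) = k * 2 := by exact_mod_cast h3
  omega

/-- A continuous unimodular character `χ : Circle →* ℂˣ` (continuity of `z ↦ (χ z : ℂ)`,
`‖χ z‖ = 1`) is `z ↦ z ^ n` for some `n : ℤ` — the shape of the weights of a compact abelian group
`K = Circle` (`lineWeight` of T5WeightDecomposition, `norm_lineWeight_eq_one`). -/
theorem exists_zpow_eq_of_norm_eq_one (χ : Circle →* ℂˣ) (hχ : Continuous fun z => (χ z : ℂ))
    (hnorm : ∀ z, ‖(χ z : ℂ)‖ = 1) :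
    ∃ n : ℤ, ∀ z, (χ z : ℂ) = (z : ℂ) ^ n := by
  let ψ : Circle →* Circle :=
    { toFun := fun z => ⟨(χ z : ℂ), mem_sphere_zero_iff_norm.2 (hnorm z)⟩
      map_one' := by ext; simp
      map_mul' := fun z w => by ext; simp }
  have hψ : Continuous ψ := Continuous.subtype_mk hχ _
  obtain ⟨n, hn⟩ := exists_zpow_eq ψ hψ
  refine ⟨n, fun z => ?_⟩
  have := congrArg (fun w : Circle => (w : ℂ)) (hn z)
  simpa [ψ] using this

/-- The same for a continuous `χ : Circle →* ℂˣ` (continuity in the topology of `ℂˣ`). -/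
theorem exists_zpow_eq_of_norm_eq_one' (χ : Circle →* ℂˣ) (hχ : Continuous χ)
    (hnorm : ∀ z, ‖(χ z : ℂ)‖ = 1) :
    ∃ n : ℤ, ∀ z, (χ z : ℂ) = (z : ℂ) ^ n :=
  exists_zpow_eq_of_norm_eq_one χ (Units.continuous_val.comp hχ) hnorm

/-- The `SO(2) = ℝ/2πℤ` form: a continuous multiplicative unimodular `χ : ℝ → ℂ` with
`χ (2π) = 1` is `θ ↦ exp (i n θ)` for some `n : ℤ`. -/
theorem exists_int_of_continuous_unimodular_periodic (χ : ℝ → ℂ) (hχ : Continuous χ)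
    (hmul : ∀ s t, χ (s + t) = χ s * χ t) (hnorm : ∀ t, ‖χ t‖ = 1) (hper : χ (2 * π) = 1) :
    ∃ n : ℤ, ∀ t, χ t = Complex.exp ((n : ℂ) * t * Complex.I) := by
  let f : ℝ → Circle := fun t => ⟨χ t, mem_sphere_zero_iff_norm.2 (hnorm t)⟩
  have hf : Continuous f := Continuous.subtype_mk hχ _
  have hfmul : ∀ s t, f (s + t) = f s * f t := fun s t => by
    ext
    simp [f, hmul]
  have hfper : f (2 * π) = 1 := by
    ext
    simp [f, hper]
  obtain ⟨n, hn⟩ := exists_int_of_continuous_hom_periodic f hf hfmul hfper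
  refine ⟨n, fun t => ?_⟩
  have := congrArg (fun w : Circle => (w : ℂ)) (hn t)
  simp only [f, Circle.coe_exp] at this
  rw [this]
  push_cast
  ring_nf

end Summit.Ventures.HodgeRepro2.T5CircleCharacters
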